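import Summits.BirchSwinnertonDyer.Rank1Residual.Partition.Corners
import Literature.NumberTheory.EllipticCurves.SkinnerUrban2014.SemistableCurvesProofs
import Literature.NumberTheory.EllipticCurves.SemistablePeuRamifieRamifiedPrime
import HarnessLib

/-!
# The strong partial theorem on SEMISTABLE curves at good ORDINARY primes with SHARP hypothesis
# lists: the refereeing-debt flag `BCS25-IMC-equiv@BSTW` never rides on a semistable curve
# (cell `b2b-bsdres`, RESIDUAL-MAP.md §A; rmap-1 gen 6)

HONEST FRAMING (run/shared/lean/b2b/bsd-rank1-residual/, verbatim in every file): the goal of the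
cell is to DELETE the COMBINATION-SHAPED residual classes of the Birch–Swinnerton-Dyer formula for
ALL analytic-rank `≤ 1` elliptic curves over `ℚ` — "full BSD formula for every rank `≤ 1` curve in
class `C`" assembled STRICTLY from published theorems — so that the rank-`≤ 1` remainder becomes
exactly the CONSTRUCTION-SHAPED classes, which are TYPED (missing-input `Prop`s), NOT attempted.
This is not "finishing BSD". Theorems only; NO definition, NO named fact introduced here; every
published theorem enters as one of the tree's existing named Literature facts BY NAME; nothing
about any particular curve is asserted; no label changes; no census number moves.

`Partition/SemistableCurves.lean` (lit-su) proves `BSD(E,p)` for every semistable `E/ℚ` of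
analytic rank `≤ 1` at every odd good ordinary `p` with `E[p]` irreducible — through the cell's
all-rows statement `StrongPartial.bsdp_of_good_odd_of_not_corner`, i.e. granted all FOURTEEN named
facts of `Partition/Bsdp.lean` (plus the Modularity Theorem and level-lowering, which discharge
(ram) by Ribet's argument, `SkinnerUrban2014.ram_of_semistable_of_irr`).  Referee-2's nit
`cornersAll-flagged-binders` (most binders idle on a given axis, their PUB\* flags riding along for
nothing) was answered on the good ordinary axis at `p ≥ 11` (`CornersLargePrime`, rmap-1 gen 4) and
at `p ≥ 5` (`CornersSharp`, rmap-1 gen 5: seven facts, `hBCS` among them).  This file answers it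
on the SEMISTABLE sub-locus of RESIDUAL-MAP §A at EVERY odd good ordinary `p` (so `p = 3`
included), where the hypothesis lists are shorter still and — the point of the file — contain
neither Burungale–Castella–Skinner 2025 (`hBCS`, PUB\*, flag `BCS25-IMC-equiv@BSTW`) nor Yan–Zhu
2026 (`hYZ`, PUB\*, flag `YZ26@3-BF-ERL-Ohta`) nor Wuthrich's Lemma 20 (`hW20`):

* rank `0`, `E[p]` irreducible: row C1 = Skinner 2016 Thm. C (`hSk`, PUB, flag-free) — its
  hypothesis (ram) is a THEOREM on semistable curves (Ribet 1990 Thm. 1.1 / Diamond 1995, from the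
  named facts `exists_isNewformOf`, `diamond1995_refinedSerre`); this is RESIDUAL-MAP §A's
  'flag-free [PUB] sub-cell: (ram) by T2 / T1' of the surjective rows, which on a semistable curve
  is the WHOLE irreducible rank-`0` cell — `bsdp_goodOrd_rankZero_of_semistable_of_irr_sharp`
  (binders `hSk`, `hmod`, `hGZK`, `hBCDT`, `hLL`);
* rank `1`, `E[p]` irreducible: row C3 = Jetchev–Skinner–Wan 2017 Thm. 1.2.1 (`hJSW`; PUB at an
  ordinary `p`, the `p = 3` proviso being automatic at an ordinary `3`; the supersingular flag
  `JSW-ss` is idle here; referee R123.2's travelling informational flag `Hid04-gap` rides with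
  `hJSW` at ordinary primes) — §A's '[PUB] sub-cell: E semistable by T4' —
  `bsdp_goodOrd_rankOne_of_semistable_of_irr_sharp` (binders `hJSW`, `hmod`, `hGZK`);
* `E[p]` reducible (on a semistable curve only `p ∈ {3, 5, 7}`: Mazur 1978 Thm. 4,
  `SkinnerUrban2014.irr_of_semistable_of_eleven_le`): outside the Eisenstein ANOMALOUS corner X1
  the pair is in row C6 (Castella–Grossi–Skinner 2025 Thm. D, `hCGS`, informational flag
  `CGS25-BST-Thm311`) or row C7 (Greenberg–Vatsal 2000 + Greenberg 1999 Thm. 4.1 + Kato, `hGV`,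
  `hGr`, literal flag `GV-chain`) — x1a's `bsdp_of_not_classX1`.

So: **for every SEMISTABLE `E/ℚ` of analytic rank `≤ 1` and every odd good ORDINARY `p`,
`BSD(E,p)` unless `(E, p) ∈ X1`, from EIGHT named facts + Modularity + level-lowering**
(`bsdp_goodOrd_of_semistable_of_not_classX1_sharp`; lit-su's form binds sixteen), SIX on the
irreducible branch (`bsdp_goodOrd_of_semistable_of_irr_sharp`), SEVEN with Mazur's torsion theorem
at `p ≥ 11` where there is no corner (`bsdp_goodOrd_of_semistable_of_eleven_le_sharp`; Skinner–Urban
2014 Cor. 3.6.10 / Remark (a) after Thm. 3.6.11 in both ranks).  Consequence recorded in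
RESIDUAL-MAP §A / §I REFEREEING DEBT: the flag `BCS25-IMC-equiv@BSTW` is confined to NON-semistable
curves (its §A domain '¬ram' in rank `0`, '¬sst ∧ ¬zhang' in rank `1`), as a kernel statement.

The rank-`0` theorem joins with the MULTIPLICATIVE axis (RESIDUAL-MAP §C, rmap-3 gen 4's
`Literature/…/SemistablePeuRamifieRamifiedPrime.lean`): at an odd multiplicative `p` that is peu
ramifié (`p ∣ ord_p(Δ_min)`) a semistable curve with `E[p]` irreducible again has (ram)
(`ram_of_semistable_of_irr_of_mult_of_dvd`), so **on a semistable curve of analytic rank `0` with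
`E[p]` irreducible, `p` odd and either good ordinary or peu-ramifié multiplicative, `BSD(E,p)` holds
from Skinner 2016 Thm. C alone** (`bsdp_rankZero_of_semistable_of_irr_sharp`; flag-free [PUB]) —
the X11a corner on semistable curves is the très-ramifié leaf `p ∤ ord_p(Δ_min)` only (rmap-3's
`not_classX11a_of_semistable_of_dvd`, `Partition/CornersThreeSemistable.lean`).

References: RESIDUAL-MAP.md §A (rows 'surjective 3' / 'surjective 5, 7, ≥ 11' and their flag-free
sub-cells; register T1/T2/T4), §C (K11a), §I REFEREEING DEBT; Skinner–Urban 2014 p. 45 and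
Cor. 3.6.10; Skinner 2016 Thm. C; Jetchev–Skinner–Wan 2017 Thm. 1.2.1 and §7.4; Ribet 1990 Thm. 1.1;
`Partition/SemistableCurves.lean` (lit-su), `Partition/CornersSharp.lean` (rmap-1 gen 5),
`Partition/CornersThreeSemistable.lean` (rmap-3 gen 4).
-/

namespace Summit.BirchSwinnertonDyer.Rank1Residual

open WeierstrassCurve Literature.NumberTheory.EllipticCurves
  Literature.NumberTheory.EllipticCurves.Rank1Residual Literature.NumberTheory.EllipticCurves.ModularForms
  Literature.NumberTheory.EllipticCurves.SkinnerUrban2014 Literature.NumberTheory.Automorphic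
open scoped NumberField

section Curve

variable {W : WeierstrassCurve ℚ} [W.IsElliptic] [W.IsGloballyMinimal] {p : ℕ} [Fact p.Prime]

/-! ### The irreducible branch, rank by rank -/

/-- **Rank `0`, SEMISTABLE, odd good ordinary `p`, `E[p]` irreducible ⇒ `BSD(E,p)` — flag-free,
FIVE binders.**  Row C1 = Skinner 2016 Thm. C (`hSk`: `p ≥ 3` good ordinary or multiplicative,
(irr), (ram), `L(E,1) ≠ 0`) with its hypothesis (ram) DISCHARGED on semistable curves by Ribet's
level-lowering-to-level-`8` argument (`SkinnerUrban2014.ram_of_semistable_of_irr`, from the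
Modularity Theorem `hBCDT` and Diamond's refined level-lowering `hLL`); `r = 0` is read by
modularity (`hmod`) and GZK (`hGZK`).  No `hBCS`: the PUB\* flag `BCS25-IMC-equiv@BSTW` does not
ride. [cite: Skinner2016PacificMC, Thm. C (§1)] [cite: SkinnerUrban2014, p. 45 (remark before
Cor. 3.6.10)] [cite: Ribet1990, Thm. 1.1] -/
theorem bsdp_goodOrd_rankZero_of_semistable_of_irr_sharp
    (hSk : Skinner2016.thmC_padicValRat_bsd_rank_zero) (hmod : hasEntireLFunction_rat)
    (hGZK : rank_eq_analyticRank_of_analyticRank_le_one) (hBCDT : exists_isNewformOf)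
    (hLL : diamond1995_refinedSerre)
    (hr0 : W.analyticRank = 0) (hp : p ≠ 2) (hsst : Semistable W) (hgo : GoodOrd W p)
    (hirr : Irr W p) : BSDp W p :=
  RowC1.bsdp hSk hmod hGZK ⟨hr0, three_le_of_ne_two hp, Or.inl hgo, hirr,
    ram_of_semistable_of_irr hBCDT hLL W p hp hgo.1 hsst hirr⟩

/-- **Rank `1`, SEMISTABLE, odd good ordinary `p`, `E[p]` irreducible ⇒ `BSD(E,p)` — THREE
binders.**  Row C3 = Jetchev–Skinner–Wan 2017 Thm. 1.2.1 (`hJSW`: semistable, `p ≥ 3` good, (irr),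
`r = 1`, and at `p = 3` the proviso "`a_3 = 0` when `E` has supersingular reduction at `3`", which
is vacuous at an ORDINARY `3`), read through modularity (`hmod`) and GZK (`hGZK`).  PUB at ordinary
primes (the flag `JSW-ss` concerns the supersingular sub-case only; referee R123.2's informational
`Hid04-gap` travels with `hJSW`). [cite: JetchevSkinnerWan2017, Thm. 1.2.1 (§1.2)] -/
theorem bsdp_goodOrd_rankOne_of_semistable_of_irr_sharp
    (hJSW : JetchevSkinnerWan2017.thm121_padicValRat_bsd_rank_one) (hmod : hasEntireLFunction_rat)
    (hGZK : rank_eq_analyticRank_of_analyticRank_le_one)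
    (hr1 : W.analyticRank = 1) (hp : p ≠ 2) (hsst : Semistable W) (hgo : GoodOrd W p)
    (hirr : Irr W p) : BSDp W p := by
  refine RowC3.bsdp hJSW hmod hGZK ⟨hr1, hsst, hgo.1, hirr, ?_⟩
  by_cases h5 : 5 ≤ p
  · exact Or.inl h5
  · have h3 : 3 ≤ p := three_le_of_ne_two hp
    have h34 : p = 3 ∨ p = 4 := by omega
    rcases h34 with rfl | rfl
    · exact Or.inr ⟨rfl, Or.inl hgo⟩
    · exact absurd (Fact.out : Nat.Prime 4) (by decide)

/-- **SEMISTABLE, analytic rank `≤ 1`, odd good ordinary `p`, `E[p]` irreducible ⇒ `BSD(E,p)` —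
SIX binders** (`hSk`, `hJSW`, `hmod`, `hGZK`, `hBCDT`, `hLL`), against the sixteen of lit-su's
`bsdp_of_semistable_of_goodOrd_of_irr` (same conclusion): the two `p`-adic inputs are Skinner 2016
Thm. C (rank `0`, (ram) by Ribet) and Jetchev–Skinner–Wan 2017 Thm. 1.2.1 (rank `1`).  This is
Skinner–Urban 2014 Thm. 3.6.11 (a) + JSW in the cell's `BSD(E,p)` currency, with NO
Burungale–Castella–Skinner / Yan–Zhu / Wuthrich-Lemma-20 binder. [cite: SkinnerUrban2014,
Thm. 3.6.11 (a) and Remark (a) (p. 46)] [cite: Skinner2016PacificMC, Thm. C]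
[cite: JetchevSkinnerWan2017, Thm. 1.2.1] -/
theorem bsdp_goodOrd_of_semistable_of_irr_sharp
    (hSk : Skinner2016.thmC_padicValRat_bsd_rank_zero)
    (hJSW : JetchevSkinnerWan2017.thm121_padicValRat_bsd_rank_one) (hmod : hasEntireLFunction_rat)
    (hGZK : rank_eq_analyticRank_of_analyticRank_le_one) (hBCDT : exists_isNewformOf)
    (hLL : diamond1995_refinedSerre)
    (hr : W.analyticRank ≤ 1) (hp : p ≠ 2) (hsst : Semistable W) (hgo : GoodOrd W p)
    (hirr : Irr W p) : BSDp W p := by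
  have hrk : W.analyticRank = 0 ∨ W.analyticRank = 1 := by omega
  rcases hrk with hr0 | hr1
  · exact bsdp_goodOrd_rankZero_of_semistable_of_irr_sharp hSk hmod hGZK hBCDT hLL hr0 hp hsst hgo hirr
  · exact bsdp_goodOrd_rankOne_of_semistable_of_irr_sharp hJSW hmod hGZK hr1 hp hsst hgo hirr

/-! ### Every semistable curve at an odd good ordinary prime: the only corner is X1 -/

/-- **SHARP §A HEADLINE ON SEMISTABLE CURVES: EIGHT named facts + Modularity + level-lowering.**
For every SEMISTABLE `E/ℚ` (globally minimal `W`) of analytic rank `≤ 1` and every odd prime `p`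
of good ORDINARY reduction (`p = 3` included), `BSD(E,p)` holds unless `(E, p)` lies in the
Eisenstein ANOMALOUS corner X1 (`red ∧ anom ∧ ¬(r = 0 ∧ gvpar)`; on a semistable curve `E[p]`
reducible forces `p ∈ {3, 5, 7}`), granted: Skinner 2016 Thm. C (`hSk`), Jetchev–Skinner–Wan 2017
Thm. 1.2.1 (`hJSW`), Castella–Grossi–Skinner 2025 Thm. D (`hCGS`, informational flag
`CGS25-BST-Thm311`), Greenberg–Vatsal 2000 Thm. 1.3 with Greenberg 1999 Thm. 4.1 in rank `0` (`hGV`,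
`hGr`; literal flag `GV-chain`), modularity (`hmod`, `hmodP`, `hBCDT`), GZK (`hGZK`), level-lowering
(`hLL`).  Irreducible branch: `bsdp_goodOrd_of_semistable_of_irr_sharp`; reducible branch: x1a's
`bsdp_of_not_classX1` (rows C6/C7).  The other §A/§B corners are empty here: X9 and X10b never meet
a semistable curve (Serre's Prop. 21 i); Ribet's (ram) at `3`), X6/X7/X8 are supersingular —
cf. lit-su's `classX1_of_goodOddCorner_of_semistable_of_goodOrd`.  Dropped relative to
`Corners.bsdp_goodOrd_of_not_corner` / lit-su's sixteen: `hBCS`, `hYZ`, `hW20`, `hCM`, `hKob`,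
`hLLT` — so NEITHER `BCS25-IMC-equiv@BSTW` NOR `YZ26@3-BF-ERL-Ohta` rides on a semistable curve at
a good ordinary prime. [cite: SkinnerUrban2014, p. 45–46] [cite: CastellaGrossiSkinner2025, Thm. D]
[cite: GreenbergVatsal2000, Thm. 1.3] [folklore] -/
theorem bsdp_goodOrd_of_semistable_of_not_classX1_sharp
    (hSk : Skinner2016.thmC_padicValRat_bsd_rank_zero)
    (hJSW : JetchevSkinnerWan2017.thm121_padicValRat_bsd_rank_one)
    (hCGS : CastellaGrossiSkinner2025.thmD_padicValRat_bsd_rank_le_one)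
    (hGV : GreenbergVatsal2000.thm13_charIdeal_eq_of_gvPar) (hGr : greenberg_charValue_rankZero)
    (hmod : hasEntireLFunction_rat) (hmodP : nonempty_modularParametrizationData)
    (hGZK : rank_eq_analyticRank_of_analyticRank_le_one) (hBCDT : exists_isNewformOf)
    (hLL : diamond1995_refinedSerre)
    (hr : W.analyticRank ≤ 1) (hp : p ≠ 2) (hsst : Semistable W) (hgo : GoodOrd W p)
    (hX1 : ¬ ClassX1 W p) : BSDp W p := by
  by_cases hirr : Irr W p
  · exact bsdp_goodOrd_of_semistable_of_irr_sharp hSk hJSW hmod hGZK hBCDT hLL hr hp hsst hgo hirr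
  · have h3 : 3 ≤ p := three_le_of_ne_two hp
    exact bsdp_of_not_classX1 hCGS hGV hGr hmod hmodP hGZK W p (by omega) hgo.1 hirr hr hX1

/-- **The partition form on semistable curves at an odd good ordinary prime: `BSD(E,p) ∨ X1`**,
from the same eight named facts + Modularity + level-lowering. [folklore] -/
theorem bsdp_or_classX1_of_semistable_of_goodOrd_sharp
    (hSk : Skinner2016.thmC_padicValRat_bsd_rank_zero)
    (hJSW : JetchevSkinnerWan2017.thm121_padicValRat_bsd_rank_one)
    (hCGS : CastellaGrossiSkinner2025.thmD_padicValRat_bsd_rank_le_one)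
    (hGV : GreenbergVatsal2000.thm13_charIdeal_eq_of_gvPar) (hGr : greenberg_charValue_rankZero)
    (hmod : hasEntireLFunction_rat) (hmodP : nonempty_modularParametrizationData)
    (hGZK : rank_eq_analyticRank_of_analyticRank_le_one) (hBCDT : exists_isNewformOf)
    (hLL : diamond1995_refinedSerre)
    (hr : W.analyticRank ≤ 1) (hp : p ≠ 2) (hsst : Semistable W) (hgo : GoodOrd W p) :
    BSDp W p ∨ ClassX1 W p := by
  by_cases hX1 : ClassX1 W p
  · exact Or.inr hX1
  · exact Or.inl (bsdp_goodOrd_of_semistable_of_not_classX1_sharp hSk hJSW hCGS hGV hGr hmod hmodP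
      hGZK hBCDT hLL hr hp hsst hgo hX1)

/-- **Skinner–Urban 2014 Cor. 3.6.10 / Remark (a), both analytic ranks, SHARP: SEMISTABLE,
analytic rank `≤ 1`, good ORDINARY `p ≥ 11` ⇒ `BSD(E,p)` with NO corner and NO image or (ram)
hypothesis — SEVEN binders** (`hSk`, `hJSW`, `hmod`, `hGZK`, `hBCDT`, `hLL`, and Mazur's torsion
theorem `hMaz`, which makes `E[p]` irreducible: `SkinnerUrban2014.irr_of_semistable_of_eleven_le`),
against the seventeen of lit-su's `bsdp_of_semistable_of_goodOrd_of_eleven_le` (same conclusion).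
[cite: SkinnerUrban2014, Cor. 3.6.10 (p. 45) and Remark (a) (p. 46)] [cite: Mazur1978, Thm. 4
(p. 131)] [cite: JetchevSkinnerWan2017, Thm. 1.2.1] -/
theorem bsdp_goodOrd_of_semistable_of_eleven_le_sharp
    (hSk : Skinner2016.thmC_padicValRat_bsd_rank_zero)
    (hJSW : JetchevSkinnerWan2017.thm121_padicValRat_bsd_rank_one) (hmod : hasEntireLFunction_rat)
    (hGZK : rank_eq_analyticRank_of_analyticRank_le_one) (hBCDT : exists_isNewformOf)
    (hLL : diamond1995_refinedSerre) (hMaz : ∀ V : WeierstrassCurve ℚ, mazur_torsion V)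
    (hr : W.analyticRank ≤ 1) (hsst : Semistable W) (h11 : 11 ≤ p) (hgo : GoodOrd W p) :
    BSDp W p :=
  bsdp_goodOrd_of_semistable_of_irr_sharp hSk hJSW hmod hGZK hBCDT hLL hr (by omega) hsst hgo
    (irr_of_semistable_of_eleven_le W p hMaz hsst h11)

/-! ### Rank `0`: the good ordinary axis joined with the peu-ramifié multiplicative axis -/

/-- **Rank `0` on SEMISTABLE curves, FLAG-FREE [PUB]: Skinner 2016 Thm. C alone.**  For a
semistable `E/ℚ` of analytic rank `0`, an odd prime `p` with `E[p]` irreducible, and `p` either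
good ORDINARY or MULTIPLICATIVE and peu ramifié (`p ∣ ord_p(Δ_min)`): `BSD(E,p)`, granted `hSk`
(+ `hmod`, `hGZK`, Modularity `hBCDT`, level-lowering `hLL`).  (ram) is a theorem in both cases —
Ribet to level `≤ 8` at a good `p` (`SkinnerUrban2014.ram_of_semistable_of_irr`, lit-su), Ribet to
level one + Serre's weight bound at a peu-ramifié multiplicative `p` (rmap-3 gen 4's
`ram_of_semistable_of_irr_of_mult_of_dvd`; cf. `bsdp_of_semistable_of_mult_of_dvd_of_irr_rankZero`
in `Partition/CornersThreeSemistable.lean`).  What is left of the rank-`0` corners of RESIDUAL-MAP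
§A/§C on a semistable curve with `E[p]` irreducible is the très-ramifié X11a leaf
`p ‖ N ∧ p ∤ ord_p(Δ_min) ∧ ¬(ram)` (empty at `p = 3`, rmap-3's `not_classX11a_three_of_semistable`;
non-empty from `p = 11` on, e.g. `11a1 @ 11`). [cite: Skinner2016PacificMC, Thm. C (§1)]
[cite: Ribet1990, Thm. 1.1] [cite: Serre1987, §2.8, §4.1] -/
theorem bsdp_rankZero_of_semistable_of_irr_sharp
    (hSk : Skinner2016.thmC_padicValRat_bsd_rank_zero) (hmod : hasEntireLFunction_rat)
    (hGZK : rank_eq_analyticRank_of_analyticRank_le_one) (hBCDT : exists_isNewformOf)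
    (hLL : diamond1995_refinedSerre)
    (hr0 : W.analyticRank = 0) (hp : p ≠ 2) (hsst : Semistable W) (hirr : Irr W p)
    (hdom : GoodOrd W p ∨ (Mult W p ∧ p ∣ padicValInt p W.minimalDiscriminantInt)) : BSDp W p := by
  rcases hdom with hgo | ⟨hm, hpeu⟩
  · exact bsdp_goodOrd_rankZero_of_semistable_of_irr_sharp hSk hmod hGZK hBCDT hLL hr0 hp hsst hgo hirr
  · exact bsdp_mult_rankZero_of_irr_of_ram hSk hmod hGZK hp hm hr0 hirr
      (Literature.NumberTheory.EllipticCurves.ram_of_semistable_of_irr_of_mult_of_dvd hBCDT hLL W p hp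
        hm hpeu hsst hirr)

/-- **Rank `0` on SEMISTABLE curves at `p ≥ 11`, good ordinary or peu-ramifié multiplicative:
`BSD(E,p)` with no image hypothesis** (Mazur 1978 Thm. 4 supplies (irr), `hMaz`); six binders.
[cite: Skinner2016PacificMC, Thm. C (§1)] [cite: Mazur1978, Thm. 4 (p. 131)] -/
theorem bsdp_rankZero_of_semistable_of_eleven_le_sharp
    (hSk : Skinner2016.thmC_padicValRat_bsd_rank_zero) (hmod : hasEntireLFunction_rat)
    (hGZK : rank_eq_analyticRank_of_analyticRank_le_one) (hBCDT : exists_isNewformOf)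
    (hLL : diamond1995_refinedSerre) (hMaz : ∀ V : WeierstrassCurve ℚ, mazur_torsion V)
    (hr0 : W.analyticRank = 0) (hsst : Semistable W) (h11 : 11 ≤ p)
    (hdom : GoodOrd W p ∨ (Mult W p ∧ p ∣ padicValInt p W.minimalDiscriminantInt)) : BSDp W p :=
  bsdp_rankZero_of_semistable_of_irr_sharp hSk hmod hGZK hBCDT hLL hr0 (by omega) hsst
    (irr_of_semistable_of_eleven_le W p hMaz hsst h11) hdom

end Curve

end Summit.BirchSwinnertonDyer.Rank1Residual
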